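import Summits.MatrixMultiplication.OmegaCensus.SmallFormats.MatMul22nRankGF5XCapSystem
import HarnessLib

/-!
# ω-census family (a): dictionary A2 — transpose check of `xcapSys5`, rows `200 … 399`

Cell `pub-omega` (unit `pub-omega-tensor-g7`), topic `Summits/MatrixMultiplication/OmegaCensus` (sub-folder `SmallFormats`).
Framing (verbatim): lottery ticket; floor = certified bounds/negative ranges. HONEST FRAMING: `decide +kernel` bookkeeping for the
kernel replay of the slack-2 X-cap certificate (transpose, part 2), split across files to respect the gate's elaboration budget.
Nothing here is progress on `ω`.
-/

namespace Summit.MatrixMultiplication.OmegaCensus.SmallFormats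

open Matrix

set_option maxRecDepth 100000 in
set_option maxHeartbeats 4000000 in
/-- Transpose check, rows `200 ≤ r < 250`. -/
theorem xcapSys5_A_eq_4 : ∀ r : Fin 498, 200 ≤ r.val ∧ r.val < 250 → ∀ j : Fin 157, xcapSys5.A r.val j.val = rowCoef5 r.val j.val := by
  decide +kernel

set_option maxRecDepth 100000 in
set_option maxHeartbeats 4000000 in
/-- Transpose check, rows `250 ≤ r < 300`. -/
theorem xcapSys5_A_eq_5 : ∀ r : Fin 498, 250 ≤ r.val ∧ r.val < 300 → ∀ j : Fin 157, xcapSys5.A r.val j.val = rowCoef5 r.val j.val := by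
  decide +kernel

set_option maxRecDepth 100000 in
set_option maxHeartbeats 4000000 in
/-- Transpose check, rows `300 ≤ r < 350`. -/
theorem xcapSys5_A_eq_6 : ∀ r : Fin 498, 300 ≤ r.val ∧ r.val < 350 → ∀ j : Fin 157, xcapSys5.A r.val j.val = rowCoef5 r.val j.val := by
  decide +kernel

set_option maxRecDepth 100000 in
set_option maxHeartbeats 4000000 in
/-- Transpose check, rows `350 ≤ r < 400`. -/
theorem xcapSys5_A_eq_7 : ∀ r : Fin 498, 350 ≤ r.val ∧ r.val < 400 → ∀ j : Fin 157, xcapSys5.A r.val j.val = rowCoef5 r.val j.val := by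
  decide +kernel

end Summit.MatrixMultiplication.OmegaCensus.SmallFormats
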